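import Summits.BirchSwinnertonDyer.BirchSwinnertonDyer.Theorems.SmallImageMuTransferMuTransferX9LocalQTerm
import Summits.BirchSwinnertonDyer.BirchSwinnertonDyer.Theorems.SmallImageMuTransferMuTransferX9StepFourCocycleSeams
import HarnessLib

/-!
# K6 crux `MuTransferX9` (stmt-BirchSwinnertonDyer-19276): the `hQ` ADAPTER — Lemma 1 (iii) (koly,
# `exists_unit_inv_cupProduct_eq_sum_convCoeff`) instantiated at the LOCAL CLASSES `loc_q[c]`, `loc_q(T^ε[Ψc])`
# in exactly the shape of the `hQ` hypothesis of x10's `StepFour.convCoeff_eq_zero_of_qTermIdentity` (p454438)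

Cell `bsd-smallim`, seat `bsd-smallim-koly` gen 8 (route `SmallImageMuTransfer`, rung K6, leaf
`Rank1Residual.BSDpOnClassX9`). HONEST FRAMING: TOOL theorem; no definition, no named fact, no `sorry`;
nothing is asserted about any curve and nothing is booked. Serves the registered stub `stub_stepsTwoFourOdd`
of crux 19276 (skeleton v6 a90a661b046bb403) and credits nothing toward its closure (`--supports … --as
helper`). PARTITION (D-0054): X9 (A4) × p ∈ {5, 7} · X10b∧¬Surj (A5) × p = 3 (odd `p`, any number field)
— helper; closes NONE.

## Content
* **`exists_unit_qTermIdentity`** — under the hypotheses of `exists_unit_inv_cupProduct_eq_sum_convCoeff`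
  (number field `K`, odd `p`, perfect `e : M × M′ → μ_p`, `ι : μ_p ↪ ℤ/p` with `ι e(v₀,w₀) = 1`, a finite
  place `q ∤ p` with `ρ`, `ρ′` unramified, `p ∣ N(q) − 1`, `χ̄_ℓ` onto on inertia, an `E`-split arithmetic
  Frobenius `Fr` of `K_q` of depth `m` (`m + 1 ≤ J`), a tame generator `t₀`, `inv.IsPerfect`): there is
  `u : ℕ → ℤ/p` with `IsUnit (u 0)` such that for EVERY global cocycle `c` of `𝒯_J = κ.twistModP ρ J` whose
  localisation at `q` is TRANSVERSE, every global cocycle `Ψc` of `𝒯′_J = κ⁻¹.twistModP ρ′ J` whose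
  localisation at `q` is UNRAMIFIED, every `ε` and every `k < J`,
  `inv_q( T_q^{J−1−k}(loc_q [c]) ∪ loc_q(T^ε [Ψc]) ) = Σ_{j ≤ k} u_j · ι C_{k−j}(c(res t₀), S^ε Ψc(res Fr))`,
  the cup product being x10's restricted `twistContPairing` and the local shift the restriction of k6-ty's
  `twistModPShift` — VERBATIM the `hQ` of `StepFour.convCoeff_eq_zero_of_qTermIdentity` with `R := ℤ/p`,
  `ι := id`, `ι' := ι`, `τq := t₀`, `Frq := Fr`.  Proof: x10's cocycle seams (`localization_oneCocycleClass`,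
  `localization_iterate_shiftH1_oneCocycleClass`, `localCocycle_iterate_shift_apply(_eq_zero_of_mem_absInertia)`)
  turn the local classes into classes of explicit local cocycles, to which Lemma 1 (iii) applies.

References: HOME/koly/MU-TRANSFER-PROOF.md §2 Lemma 1 (iii), §5 STEP 4; B. Mazur, K. Rubin, Mem. AMS 799
(2004) Prop. 1.3.2 [MazurRubin2004]; K. Rubin, PCMI 18 (2011) Prop. 1.9.5 [Rubin2011].
-/

set_option linter.dupNamespace false
set_option autoImplicit false

noncomputable section

open scoped Classical ContRepresentation

universe u

namespace Summit.BirchSwinnertonDyer.BirchSwinnertonDyer.Rank1Residual.LocalSplitPrime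

open CategoryTheory ContinuousCohomology Function Field ValuativeRel NumberField IsDedekindDomain Finset
open Literature.NumberTheory.GaloisRepresentations
open Literature.NumberTheory.GaloisRepresentations.IsNonarchimedeanLocalField
open _root_.TopRep
open Literature.NumberTheory.GaloisCohomology
open Literature.NumberTheory.EllipticCurves
open Summit.BirchSwinnertonDyer.Rank1Residual.GaloisImage

section Adapter

variable {K : Type u} [Field K] [NumberField K] {p : ℕ} [Fact p.Prime]
  {M M' : Type u} [AddCommGroup M] [TopologicalSpace M] [DiscreteTopology M] [Finite M]
  [AddCommGroup M'] [TopologicalSpace M'] [DiscreteTopology M'] [Finite M']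
  (ρ : DiscreteGaloisModule K M) (ρ' : DiscreteGaloisModule K M')
  (hM : ∀ x : M, p • x = 0) (hM' : ∀ x : M', p • x = 0) (κ : ZpExtension K p) (J : ℕ)
  (q : HeightOneSpectrum (𝓞 K)) [Fact (Ideal.absNorm q.asIdeal).Prime]
  [NeZero ((Ideal.absNorm q.asIdeal : ℕ) : q.adicCompletion K)]
  -- the cup product of the RESTRICTED pairing lives on `Γ_{K_q}` written as `absoluteGaloisGroup
  -- (Place.Completion (Sum.inr q))` (x10's spelling); `LocallyCompactSpace` is a `Prop` (tree theorem
  -- `absoluteGaloisGroup_compactSpace`), taken as an instance binder as in x10's StepFour files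
  [LocallyCompactSpace (absoluteGaloisGroup (Place.Completion (Sum.inr q : Place K)))]

/-- **The `hQ` adapter**: koly's Lemma 1 (iii) (`exists_unit_inv_cupProduct_eq_sum_convCoeff`) at the local
classes `loc_q [c]` (transverse) and `loc_q (T^ε [Ψc])` (unramified), in the verbatim shape of the `hQ`
hypothesis of x10's `StepFour.convCoeff_eq_zero_of_qTermIdentity` (`R := ZMod p`, `ι := id`, `ι' := ι`,
`τq := t₀`, `Frq := Fr`).  The unit `u` depends only on the local data at `q` (not on `c`, `Ψc`, `ε`).
[cite: MazurRubin2004, Prop. 1.3.2 (p. 12)] [cite: Rubin2011, Prop. 1.9.5 (p. 16)] -/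
theorem exists_unit_qTermIdentity (hp : p ≠ 2)
    {e : M →+ M' →+ DiscreteGaloisModule.MuCarrier K p}
    (he : ∀ (g : absoluteGaloisGroup K) (a : M) (b : M'),
      e (ρ g a) (ρ' g b) = DiscreteGaloisModule.mu K p g (e a b))
    (hnd : ∀ b : M', (∀ a : M, e a b = 0) → b = 0)
    (hsurj : ∀ χ : M →+ DiscreteGaloisModule.MuCarrier K p, ∃ b : M', ∀ a, e a b = χ a)
    (ι : DiscreteGaloisModule.MuCarrier K p →+ ZMod p) (hι : Function.Injective ι)
    {v₀ : M} {w₀ : M'} (h1 : ι (e v₀ w₀) = 1)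
    (hunr : GaloisRep.IsUnramifiedAt q ρ) (hunr' : GaloisRep.IsUnramifiedAt q ρ')
    (hqp : (p : 𝓞 K) ∉ q.asIdeal) (hpl : p ∣ Ideal.absNorm q.asIdeal - 1)
    (hχI : ∀ u : (ZMod (Ideal.absNorm q.asIdeal))ˣ, ∃ t ∈ absInertia (q.adicCompletion K),
      modPCyclotomicCharacterZMod (q.adicCompletion K) (Ideal.absNorm q.asIdeal) t = u)
    {Fr : absoluteGaloisGroup (q.adicCompletion K)} (hFr : IsAbsArithFrob Fr)
    (hsplit : ρ (absGaloisRestrict K (q.adicCompletion K) Fr) = 1)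
    (hsplit' : ρ' (absGaloisRestrict K (q.adicCompletion K) Fr) = 1) {m : ℕ} (hm : m + 1 ≤ J)
    (hFrm : absGaloisRestrict K (q.adicCompletion K) Fr ∈ κ.layerSubgroup m)
    (hFrm' : absGaloisRestrict K (q.adicCompletion K) Fr ∉ κ.layerSubgroup (m + 1))
    {t₀ : absoluteGaloisGroup (q.adicCompletion K)} (ht₀ : t₀ ∈ absInertia (q.adicCompletion K))
    (hgen : ∀ u : (ZMod (Ideal.absNorm q.asIdeal))ˣ,
      u ∈ Subgroup.zpowers (modPCyclotomicCharacterZMod (q.adicCompletion K) (Ideal.absNorm q.asIdeal) t₀))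
    (inv : LocalInvariants K p) (hperf : inv.IsPerfect) :
    ∃ u : ℕ → ZMod p, IsUnit (u 0) ∧
      ∀ (c : contOneCocycles (κ.twistModP ρ hM J).toTopRep),
        galoisCohomology.localization (κ.twistModP ρ hM J) (Sum.inr q) 1
            (oneCocycleClass (κ.twistModP ρ hM J).toTopRep c) ∈
          DiscreteGaloisModule.transverseSubgroup (GaloisRep.toLocal q (κ.twistModP ρ hM J))
            (CyclotomicField (Ideal.absNorm q.asIdeal) (q.adicCompletion K)) →
      ∀ (Ψc : contOneCocycles (κ.invTwist.twistModP ρ' hM' J).toTopRep),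
        galoisCohomology.localization (κ.invTwist.twistModP ρ' hM' J) (Sum.inr q) 1
            (oneCocycleClass (κ.invTwist.twistModP ρ' hM' J).toTopRep Ψc) ∈
          DiscreteGaloisModule.unramifiedSubgroup (GaloisRep.toLocal q (κ.invTwist.twistModP ρ' hM' J)) 1 →
      ∀ (ε k : ℕ), k < J →
        inv (Sum.inr q)
          (((κ.twistContPairing ρ ρ' (DiscreteGaloisModule.mu K p) hM hM' J he).restrict
              (absGaloisRestrict K (Place.Completion (Sum.inr q : Place K)))).cupProduct
            ((galoisCohomology.map ((κ.twistModPShift ρ hM J).restrictField (q.adicCompletion K)) 1)^[J - 1 - k]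
              (galoisCohomology.localization (κ.twistModP ρ hM J) (Sum.inr q) 1
                (oneCocycleClass (κ.twistModP ρ hM J).toTopRep c)))
            (galoisCohomology.localization (κ.invTwist.twistModP ρ' hM' J) (Sum.inr q) 1
              ((κ.invTwist.shiftH1 ρ' hM' J)^[ε]
                (oneCocycleClass (κ.invTwist.twistModP ρ' hM' J).toTopRep Ψc)))) =
        ∑ j ∈ Finset.range (k + 1), u j * ι (convCoeff e J (k - j)
          (c.1 (absGaloisRestrict K (q.adicCompletion K) t₀))
          ((shiftEnd M' J ^ ε) (Ψc.1 (absGaloisRestrict K (q.adicCompletion K) Fr)))) := by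
  classical
  haveI : LocallyCompactSpace (absoluteGaloisGroup (q.adicCompletion K)) :=
    ‹LocallyCompactSpace (absoluteGaloisGroup (Place.Completion (Sum.inr q : Place K)))›
  -- Lemma 1 (iii) for the restricted pairing `P` and the restricted shift `S`
  obtain ⟨u, hu0, hu⟩ := exists_unit_inv_cupProduct_eq_sum_convCoeff ρ ρ' hM hM' κ J q hp he hnd hsurj ι hι
    h1 hunr hunr' hqp hpl hχI hFr hsplit hsplit' hm hFrm hFrm' ht₀ hgen inv hperf
    ((κ.twistContPairing ρ ρ' (DiscreteGaloisModule.mu K p) hM hM' J he).restrict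
      (absGaloisRestrict K (Place.Completion (Sum.inr q : Place K))))
    (fun _ _ => rfl) ((κ.twistModPShift ρ hM J).restrictField (q.adicCompletion K)) (fun _ => rfl)
  refine ⟨u, isUnit_iff_ne_zero.2 hu0, fun c hc Ψc hΨ ε k hk => ?_⟩
  -- the local classes are classes of explicit local cocycles (x10's seams)
  rw [StepFour.localization_oneCocycleClass (κ.twistModP ρ hM J) q c] at hc ⊢
  rw [StepFour.localization_iterate_shiftH1_oneCocycleClass κ.invTwist ρ' hM' J q Ψc ε]
  have hψ : ∀ t ∈ absInertia (q.adicCompletion K),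
      (contOneCocycles.pullback (absGaloisRestrict K (q.adicCompletion K))
        (X := (κ.invTwist.twistModP ρ' hM' J).toTopRep)
        (Y := (GaloisRep.toLocal q (κ.invTwist.twistModP ρ' hM' J)).toTopRep)
        (TopRep.ofHom ⟨ContinuousLinearMap.id ℤ (Fin J → M'), fun _ => rfl⟩)
        ((κ.invTwist.pushCocycle ρ' hM' J (κ.invTwist.twistModPShift ρ' hM' J))^[ε] Ψc)).1 t = 0 :=
    fun t ht => StepFour.localCocycle_iterate_shift_apply_eq_zero_of_mem_absInertia κ.invTwist ρ' hM' J q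
      hunr' hqp Ψc hΨ ε ht
  have h := hu k hk _ _ hc hψ
  rw [StepFour.pullback_absGaloisRestrict_apply, StepFour.localCocycle_iterate_shift_apply] at h
  exact h

end Adapter

end Summit.BirchSwinnertonDyer.BirchSwinnertonDyer.Rank1Residual.LocalSplitPrime

end
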